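import Summits.CriticalPhenomena.Ising3DConformalLimit.Theorems.EnergyNotSigmaSquaredMoebiusLimitExistsDefs
import Mathlib.Topology.MetricSpace.Cauchy
import Mathlib.Topology.Sequences
import Mathlib.Topology.Bases
import HarnessLib

/-!
# The Arzelà–Ascoli / diagonal schema behind the compactness of the pinned zoom
(line `only-interaction-breaks-moebius` of the crux `MoebiusLimitExists`, item stmt-CriticalPhenomena-1344;
registered sub-goal `compactnessSchema` of the stub `stub_compactness`)

A MODEL-INDEPENDENT subsequence principle. Let `F n k : (ℝ³)ⁿ → ℝ` (`n k : ℕ`) be real functions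
(in the line: the pinned rescaled critical `n`-point correlators of `ℤ³` at the `k`-th mesh; they are
cell functions of a grid, NOT continuous) such that on every compact set `K` of non-coincident
configurations (`K ⊆ NonCoincident 3 n`)
* the `F n k` are EVENTUALLY (in `k`) uniformly bounded on `K`, and
* the `F n k` are ASYMPTOTICALLY EQUICONTINUOUS on `K`: for every `ε > 0` there is `η > 0` with
  `|F n k x − F n k y| < ε` for all `x, y ∈ K`, `dist x y < η`, for all large `k`.
Then ONE strictly increasing `φ : ℕ → ℕ` and a family `S : CorrFamily 3` exist with `S` normalised
(zero off `NonCoincident`), every `S n` continuous on `NonCoincident 3 n`, and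
`F n (φ k) → S n` locally uniformly on `NonCoincident 3 n` for EVERY `n` (`compactnessSchema`).

Proof (classical Arzelà–Ascoli with a Cantor diagonal, done by hand because the `F n k` are not
continuous, so Mathlib's `ArzelaAscoli` does not apply verbatim):
1. `(ℝ³)ⁿ` is separable: fix countable dense sets `Q n`; the index type
   `ι = Σ n, ↥(Q n ∩ NonCoincident 3 n)` is countable.
2. At each index the real sequence `k ↦ F n k d` is bounded (eventually bounded by the first
   hypothesis on the compact `{d}`, and finitely many earlier terms;
   `exists_forall_abs_le_of_eventually`), so `k ↦ (F n k d)_{(n,d) ∈ ι}` lives in the compact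
   metrisable cube `Π_ι [−B_i, B_i]` (Tychonoff) and has a convergent subsequence `φ`: all the
   countably many sequences converge along `φ` (`exists_strictMono_forall_tendsto`).
3. `ε/3`-argument: on a compact `K ⊆ U` (open `U`), squeeze a compact `L` with `K ⊆ interior L ⊆ L ⊆ U`
   (local compactness), cover `K` by finitely many `η`-balls centred at dense points of `interior L`,
   and combine equicontinuity on `L` with the Cauchy property at the centres: the sequence is
   uniformly Cauchy on `K` (`uniformCauchySeqOn_of_dense`).
4. Hence pointwise limits `S n x := lim_k F n (φ k) x` exist on `NonCoincident 3 n` (set `S n := 0`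
   elsewhere), the convergence is uniform on every compact `K ⊆ NonCoincident 3 n`, i.e. locally
   uniform on the open set `NonCoincident 3 n` of the locally compact space `(ℝ³)ⁿ`
   (`tendstoLocallyUniformlyOn_iff_forall_isCompact`), and asymptotic equicontinuity passes to the
   limit, giving continuity of `S n` on `NonCoincident 3 n` (`continuousOn_of_tendsto_of_equicontinuous`).

No lattice content: the physics of `stub_compactness` (local bounds and asymptotic equicontinuity of
the pinned zoom, translation invariance of its cluster points) is supplied elsewhere.

References: folklore (Arzelà–Ascoli, Cantor diagonal argument); Mathlib anchors
`IsCompact.tendsto_subseq`, `isCompact_univ_pi`, `tendsto_pi_nhds`, `exists_compact_between`,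
`Metric.uniformCauchySeqOn_iff`, `UniformCauchySeqOn.tendstoUniformlyOn_of_tendsto`,
`tendstoLocallyUniformlyOn_iff_forall_isCompact`, `TopologicalSpace.exists_countable_dense`.
-/

noncomputable section

open Filter Topology Set Function
open Literature.Probability.LatticeModels

namespace Summit.CriticalPhenomena.Ising3DConformalLimit.MoebiusLimitExistsOnlyInteraction

/-! ### Bounded real sequences and the diagonal subsequence -/

/-- An eventually bounded real sequence is bounded: if `|f k| ≤ B` for all large `k` then
`|f k| ≤ B'` for all `k` (with `B' = B + Σ_{k<N} |f k|`). [folklore] -/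
theorem exists_forall_abs_le_of_eventually {f : ℕ → ℝ} {B : ℝ}
    (h : ∀ᶠ k in atTop, |f k| ≤ B) : ∃ B' : ℝ, ∀ k, |f k| ≤ B' := by
  obtain ⟨N, hN⟩ := eventually_atTop.1 h
  refine ⟨B + ∑ k ∈ Finset.range N, |f k|, fun k => ?_⟩
  have hB0 : 0 ≤ B := (abs_nonneg _).trans (hN N le_rfl)
  have hS0 : 0 ≤ ∑ k ∈ Finset.range N, |f k| := Finset.sum_nonneg fun _ _ => abs_nonneg _
  by_cases hk : N ≤ k
  · exact (hN k hk).trans (le_add_of_nonneg_right hS0)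
  · have h1 : |f k| ≤ ∑ k ∈ Finset.range N, |f k| :=
      Finset.single_le_sum (f := fun k => |f k|) (fun _ _ => abs_nonneg _)
        (Finset.mem_range.2 (not_le.1 hk))
    exact h1.trans (le_add_of_nonneg_left hB0)

/-- **Cantor diagonal via Tychonoff.** Countably many bounded real sequences `k ↦ G k i` (`i : ι`,
`ι` countable) converge simultaneously along ONE strictly increasing subsequence `φ`: the sequence
`k ↦ G k` lives in the compact metrisable cube `Π i, [−B i, B i]`. [folklore] -/
theorem exists_strictMono_forall_tendsto {ι : Type*} [Countable ι] (G : ℕ → ι → ℝ)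
    (hG : ∀ i, ∃ B, ∀ k, |G k i| ≤ B) :
    ∃ (φ : ℕ → ℕ) (a : ι → ℝ), StrictMono φ ∧
      ∀ i, Tendsto (fun k => G (φ k) i) atTop (𝓝 (a i)) := by
  choose B hB using hG
  have hcpt : IsCompact (Set.pi univ fun i : ι => Icc (-(B i)) (B i)) :=
    isCompact_univ_pi fun _ => isCompact_Icc
  have hmem : ∀ k, G k ∈ Set.pi univ fun i : ι => Icc (-(B i)) (B i) :=
    fun k i _ => abs_le.1 (hB i k)
  obtain ⟨a, -, φ, hφ, hlim⟩ := hcpt.tendsto_subseq hmem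
  exact ⟨φ, a, hφ, fun i => tendsto_pi_nhds.1 hlim i⟩

/-! ### The `ε/3` arguments -/

/-- **Arzelà–Ascoli step.** On a locally compact metric space, a sequence of real functions that is
Cauchy at every point of a dense set lying in the open set `U` and asymptotically equicontinuous on
every compact subset of `U` is uniformly Cauchy on every compact `K ⊆ U` (`ε/3`-argument through a
compact `L`, `K ⊆ interior L`, `L ⊆ U`, and a finite cover of `K` by `η`-balls centred at dense points
of `interior L`). [folklore] -/
theorem uniformCauchySeqOn_of_dense {X : Type*} [MetricSpace X] [LocallyCompactSpace X]
    {G : ℕ → X → ℝ} {U Q : Set X} (hU : IsOpen U) (hQ : Dense Q)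
    (hC : ∀ d ∈ Q, d ∈ U → CauchySeq fun k => G k d)
    (hE : ∀ K, IsCompact K → K ⊆ U → ∀ ε > 0, ∃ η > 0, ∀ᶠ k in atTop,
      ∀ x ∈ K, ∀ y ∈ K, dist x y < η → |G k x - G k y| < ε)
    {K : Set X} (hK : IsCompact K) (hKU : K ⊆ U) : UniformCauchySeqOn G atTop K := by
  obtain ⟨L, hL, hKL, hLU⟩ := exists_compact_between hK hU hKU
  rw [Metric.uniformCauchySeqOn_iff]
  intro ε hε
  have hε3 : 0 < ε / 3 := by positivity
  obtain ⟨η, hη, hev⟩ := hE L hL hLU (ε / 3) hε3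
  obtain ⟨N₁, hN₁⟩ := eventually_atTop.1 hev
  -- cover `K` by `η`-balls centred at points of `Q ∩ interior L`
  have hcover : K ⊆ ⋃ d : ↥(Q ∩ interior L), Metric.ball (d : X) η := by
    intro x hx
    obtain ⟨d, hdQ, hdint, hdx⟩ := hQ.exists_mem_open (isOpen_interior.inter Metric.isOpen_ball)
      ⟨x, hKL hx, Metric.mem_ball_self hη⟩
    exact mem_iUnion.2 ⟨⟨d, hdQ, hdint⟩, Metric.mem_ball_comm.1 hdx⟩
  obtain ⟨t, ht⟩ := hK.elim_finite_subcover (fun d : ↥(Q ∩ interior L) => Metric.ball (d : X) η)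
    (fun _ => Metric.isOpen_ball) hcover
  -- the finitely many centres are Cauchy
  have hC' : ∀ d : ↥(Q ∩ interior L), ∃ N, ∀ m ≥ N, ∀ m' ≥ N,
      dist (G m d) (G m' d) < ε / 3 :=
    fun d => Metric.cauchySeq_iff.1 (hC d d.2.1 (hLU (interior_subset d.2.2))) (ε / 3) hε3
  choose Nd hNd using hC'
  refine ⟨max N₁ (t.sup Nd), fun m hm m' hm' x hx => ?_⟩
  obtain ⟨d, hdt, hxd⟩ := mem_iUnion₂.1 (ht hx)
  have hxd' : dist x (d : X) < η := hxd
  have hm1 : N₁ ≤ m := (le_max_left _ _).trans hm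
  have hm1' : N₁ ≤ m' := (le_max_left _ _).trans hm'
  have hmd : Nd d ≤ m := ((Finset.le_sup hdt).trans (le_max_right _ _)).trans hm
  have hmd' : Nd d ≤ m' := ((Finset.le_sup hdt).trans (le_max_right _ _)).trans hm'
  have hxL : x ∈ L := interior_subset (hKL hx)
  have hdL : (d : X) ∈ L := interior_subset d.2.2
  have h1 : |G m x - G m d| < ε / 3 := hN₁ m hm1 x hxL d hdL hxd'
  have h2 : dist (G m d) (G m' d) < ε / 3 := hNd d m hmd m' hmd'
  have h3 : |G m' x - G m' d| < ε / 3 := hN₁ m' hm1' x hxL d hdL hxd'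
  rw [Real.dist_eq] at h2 ⊢
  rw [abs_sub_comm] at h3
  calc |G m x - G m' x| ≤ |G m x - G m d| + |G m d - G m' x| := abs_sub_le _ _ _
    _ ≤ |G m x - G m d| + (|G m d - G m' d| + |G m' d - G m' x|) := by
        gcongr
        exact abs_sub_le _ _ _
    _ < ε / 3 + (ε / 3 + ε / 3) := add_lt_add h1 (add_lt_add h2 h3)
    _ = ε := by ring

/-- **Equicontinuity passes to the limit.** On a locally compact metric space, the pointwise limit on
the open set `U` of a sequence of real functions that is asymptotically equicontinuous on every
compact subset of `U` is continuous on `U`. [folklore] -/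
theorem continuousOn_of_tendsto_of_equicontinuous {X : Type*} [MetricSpace X]
    [LocallyCompactSpace X] {G : ℕ → X → ℝ} {g : X → ℝ} {U : Set X} (hU : IsOpen U)
    (hlim : ∀ x ∈ U, Tendsto (fun k => G k x) atTop (𝓝 (g x)))
    (hE : ∀ K, IsCompact K → K ⊆ U → ∀ ε > 0, ∃ η > 0, ∀ᶠ k in atTop,
      ∀ x ∈ K, ∀ y ∈ K, dist x y < η → |G k x - G k y| < ε) :
    ContinuousOn g U := by
  intro x₀ hx₀
  refine ContinuousAt.continuousWithinAt ?_
  rw [Metric.continuousAt_iff]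
  intro ε hε
  obtain ⟨L, hL, hx₀L, hLU⟩ :=
    exists_compact_between isCompact_singleton hU (singleton_subset_iff.2 hx₀)
  have hx₀int : x₀ ∈ interior L := hx₀L (mem_singleton x₀)
  obtain ⟨r, hr, hball⟩ := Metric.mem_nhds_iff.1 (isOpen_interior.mem_nhds hx₀int)
  obtain ⟨η, hη, hev⟩ := hE L hL hLU (ε / 2) (half_pos hε)
  refine ⟨min r η, lt_min hr hη, fun {y} hy => ?_⟩
  have hyr : dist y x₀ < r := lt_of_lt_of_le hy (min_le_left _ _)
  have hyη : dist y x₀ < η := lt_of_lt_of_le hy (min_le_right _ _)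
  have hyL : y ∈ L := interior_subset (hball hyr)
  have hx₀L' : x₀ ∈ L := interior_subset hx₀int
  have hT : Tendsto (fun k => |G k y - G k x₀|) atTop (𝓝 |g y - g x₀|) :=
    ((hlim y (hLU hyL)).sub (hlim x₀ hx₀)).abs
  have hle : |g y - g x₀| ≤ ε / 2 :=
    le_of_tendsto hT (hev.mono fun k hk => (hk y hyL x₀ hx₀L' hyη).le)
  rw [Real.dist_eq]
  linarith

/-! ### The schema -/

/-- **Registered sub-goal `compactnessSchema` of `stub_compactness`** (line
`only-interaction-breaks-moebius`): the model-independent Arzelà–Ascoli/diagonal schema. If for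
every `n` the real functions `F n k` on `(ℝ³)ⁿ` are eventually uniformly bounded and asymptotically
equicontinuous on every compact set of non-coincident configurations, then along ONE strictly
increasing subsequence `φ` they converge, for every `n`, locally uniformly on `NonCoincident 3 n` to
a normalised family `S` each of whose members is continuous on `NonCoincident 3 n`. [folklore] -/
theorem compactnessSchema :
    ∀ F : (n : ℕ) → ℕ → (Fin n → EuclideanSpace ℝ (Fin 3)) → ℝ,
      (∀ n (K : Set (Fin n → EuclideanSpace ℝ (Fin 3))), IsCompact K → K ⊆ NonCoincident 3 n →
        ∃ B : ℝ, ∀ᶠ k in atTop, ∀ x ∈ K, |F n k x| ≤ B) →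
      (∀ n (K : Set (Fin n → EuclideanSpace ℝ (Fin 3))), IsCompact K → K ⊆ NonCoincident 3 n →
        ∀ ε > 0, ∃ η > 0, ∀ᶠ k in atTop, ∀ x ∈ K, ∀ y ∈ K, dist x y < η → |F n k x - F n k y| < ε) →
      ∃ (φ : ℕ → ℕ) (S : CorrFamily 3), StrictMono φ ∧ IsNormalised S ∧
        (∀ n, ContinuousOn (S n) (NonCoincident 3 n)) ∧
        ∀ n, TendstoLocallyUniformlyOn (fun k => F n (φ k)) (S n) atTop (NonCoincident 3 n) := by
  intro F hB hE
  classical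
  -- (1) countable dense subsets of the configuration spaces, one countable index type
  have hQ : ∀ n : ℕ, ∃ Q : Set (Fin n → EuclideanSpace ℝ (Fin 3)), Q.Countable ∧ Dense Q :=
    fun n => TopologicalSpace.exists_countable_dense _
  choose Q hQc hQd using hQ
  haveI : ∀ n, Countable ↥(Q n ∩ NonCoincident 3 n) :=
    fun n => ((hQc n).mono inter_subset_left).to_subtype
  -- (2) every sequence `k ↦ F n k d` is bounded; one diagonal subsequence for all `(n, d)`
  have hGb : ∀ i : (Σ n : ℕ, ↥(Q n ∩ NonCoincident 3 n)), ∃ B, ∀ k,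
      |F i.1 k (i.2 : Fin i.1 → EuclideanSpace ℝ (Fin 3))| ≤ B := by
    rintro ⟨n, d, hdQ, hdU⟩
    obtain ⟨B, hBev⟩ := hB n {d} isCompact_singleton (singleton_subset_iff.2 hdU)
    have h1 : ∀ᶠ k in atTop, |F n k d| ≤ B := hBev.mono fun k hk => hk d (mem_singleton d)
    exact exists_forall_abs_le_of_eventually h1
  obtain ⟨φ, a, hφ, hpt⟩ := exists_strictMono_forall_tendsto
    (fun k (i : Σ n : ℕ, ↥(Q n ∩ NonCoincident 3 n)) =>
      F i.1 k (i.2 : Fin i.1 → EuclideanSpace ℝ (Fin 3))) hGb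
  -- (3) asymptotic equicontinuity survives along the subsequence
  have hE' : ∀ n (K : Set (Fin n → EuclideanSpace ℝ (Fin 3))), IsCompact K →
      K ⊆ NonCoincident 3 n → ∀ ε > 0, ∃ η > 0, ∀ᶠ k in atTop, ∀ x ∈ K, ∀ y ∈ K, dist x y < η →
        |F n (φ k) x - F n (φ k) y| < ε := by
    intro n K hK hKU ε hε
    obtain ⟨η, hη, hev⟩ := hE n K hK hKU ε hε
    exact ⟨η, hη, hφ.tendsto_atTop.eventually hev⟩
  -- (4) uniformly Cauchy on every compact set of non-coincident configurations
  have hUC : ∀ n (K : Set (Fin n → EuclideanSpace ℝ (Fin 3))), IsCompact K →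
      K ⊆ NonCoincident 3 n → UniformCauchySeqOn (fun k => F n (φ k)) atTop K := by
    intro n K hK hKU
    refine uniformCauchySeqOn_of_dense (G := fun k => F n (φ k)) (isOpen_nonCoincident 3 n)
      (hQd n) ?_ (hE' n) hK hKU
    intro d hdQ hdU
    exact (hpt ⟨n, d, hdQ, hdU⟩).cauchySeq
  -- (5) the limit family, normalised by definition
  let S : CorrFamily 3 := fun n x =>
    if x ∈ NonCoincident 3 n then limUnder atTop (fun k => F n (φ k) x) else 0
  have hlim : ∀ n, ∀ x ∈ NonCoincident 3 n,
      Tendsto (fun k => F n (φ k) x) atTop (𝓝 (S n x)) := by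
    intro n x hx
    have hc : CauchySeq fun k => F n (φ k) x :=
      (hUC n {x} isCompact_singleton (singleton_subset_iff.2 hx)).cauchySeq (mem_singleton x)
    simp only [S, if_pos hx]
    exact hc.tendsto_limUnder
  refine ⟨φ, S, hφ, ?_, ?_, ?_⟩
  · -- normalised
    intro n x hx
    simp only [S, if_neg hx]
  · -- continuous off the diagonals
    intro n
    exact continuousOn_of_tendsto_of_equicontinuous (isOpen_nonCoincident 3 n) (hlim n) (hE' n)
  · -- locally uniform convergence = uniform convergence on compacts (locally compact space)
    intro n
    rw [tendstoLocallyUniformlyOn_iff_forall_isCompact (isOpen_nonCoincident 3 n)]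
    intro K hKU hK
    exact (hUC n K hK hKU).tendstoUniformlyOn_of_tendsto fun x hx => hlim n x (hKU hx)

end Summit.CriticalPhenomena.Ising3DConformalLimit.MoebiusLimitExistsOnlyInteraction

end
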